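import Mathlib.Analysis.Calculus.Deriv.Shift
import Literature.Analysis.Calculus.LogCutoff
import Literature.Analysis.FunctionSpaces.TorusShearKoopman
import HarnessLib

/-!
# K1loc, line `Spectral` / SeqCone — helper: SMOOTH STRIP CUT-OFFS SUBORDINATE TO THE FLAT STRIPS (S-B data)

Helper file of the prover lane on the crux `K1LocalisedCascade` (stmt-AnomalousDissipation-19491), route
`SawtoothPulseCascade` (memo v6 §2/S-B: "smooth partition subordinate to the flat strips").  Given a slope function
`V : ℝ → ℝ` (for the cascade: `V = U_j′`, `|V| ≤ 1`, equal to `±1` up to exponentially small errors on the flats) and a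
width `0 < ε ≤ 1/2`, the cut-off of the `+` family is
  `X⁺(y) = smoothTransition((V(y) − (1 − 2ε))/ε)`        (`X⁻` = the same with `−V`),
Mathlib's `Real.smoothTransition` (C^∞, `0` on `(−∞,0]`, `1` on `[1,∞)`, values in `[0,1]`).  This file proves what the
half-slot machinery (`…K1Slot`) asks of the cut-offs: values in `[0,1]`; `X⁺ ≠ 0 ⇒ V > 1 − 2ε` and `X⁺′ ≠ 0 ⇒
1 − 2ε < V < 1 − ε` (the flatness hypothesis `hflat` of the slot lemma `…SlotCascade.sqrt_tsum_symbolEnergy_le_H_of_Ico` with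
`ε₁ = 2ε`); `X⁺ = 1` where `V ≥ 1 − ε`; `X⁺·X⁻ = 0` and `X⁺² + X⁻² ≤ 1` (the disjointness / sub-partition hypotheses of the
un-gauging step `…SlotFibreMax`); the zone `{X⁺ + X⁻ < 1} ⊆ {|V| < 1 − ε}`; the chain-rule derivative and the bounds
`|X⁺′| ≤ (C₁/ε)|V′|`, `|X⁺″| ≤ (C₂/ε²)V′² + (C₁/ε)|V″|` with `C₁, C₂` sup bounds of the first two derivatives of the smooth
transition (tree: `Literature.Analysis.Calculus.exists_bound_deriv_smoothTransition`,
`exists_abs_deriv_and_deriv_deriv_smoothTransition_le`); smoothness and `1`-periodicity (so `X^±` are `ShearProfile`s).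
No definitions; no statement about the stub.
[cite: ElgindiLissMattingly2025, §1 (the flat strips of the sawtooth shears H_α, V_α)] [problem: turb]
-/

-- `Summit.<Summit>.<Problem>`: single-conjunct summit, the duplicate namespace segment is deliberate.
set_option linter.dupNamespace false

noncomputable section

namespace Summit.AnomalousDissipation.AnomalousDissipation.Theorems.SawtoothPulseCascade.K1Cutoff

open Set Filter Topology Real
open scoped ContDiff
open Literature.Analysis.Calculus (differentiable_smoothTransition deriv_smoothTransition_of_nonpos
  deriv_smoothTransition_of_one_le contDiff_deriv_smoothTransition)

/-! ## The cut-off of one strip family: `X(y) = smoothTransition((V(y) − (1 − 2ε))/ε)` -/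

/-- Values in `[0,1]`: `0 ≤ X`. [folklore] -/
theorem cutoff_nonneg (V : ℝ → ℝ) (ε y : ℝ) : 0 ≤ smoothTransition ((V y - (1 - 2 * ε)) / ε) :=
  Real.smoothTransition.nonneg _

/-- Values in `[0,1]`: `X ≤ 1`. [folklore] -/
theorem cutoff_le_one (V : ℝ → ℝ) (ε y : ℝ) : smoothTransition ((V y - (1 - 2 * ε)) / ε) ≤ 1 :=
  Real.smoothTransition.le_one _

/-- Values in `[0,1]`: `|X| ≤ 1` (the form `hX1` of the slot lemma). [folklore] -/
theorem abs_cutoff_le_one (V : ℝ → ℝ) (ε y : ℝ) : |smoothTransition ((V y - (1 - 2 * ε)) / ε)| ≤ 1 := by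
  rw [abs_of_nonneg (cutoff_nonneg V ε y)]; exact cutoff_le_one V ε y

/-- **Flatness on the support**: `X(y) ≠ 0 ⇒ V(y) > 1 − 2ε` (`ε > 0`).
[cite: ElgindiLissMattingly2025, §1 (flat strips)] -/
theorem lt_of_cutoff_ne_zero {V : ℝ → ℝ} {ε : ℝ} (hε : 0 < ε) {y : ℝ}
    (h : smoothTransition ((V y - (1 - 2 * ε)) / ε) ≠ 0) : 1 - 2 * ε < V y := by
  by_contra hle
  push Not at hle
  exact h (Real.smoothTransition.zero_of_nonpos (div_nonpos_of_nonpos_of_nonneg (by linarith) hε.le))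

/-- **Flatness on the support, two-sided**: if moreover `V ≤ 1` then `X(y) ≠ 0 ⇒ |V(y) − 1| ≤ 2ε` — the hypothesis
`hflat` of the slot lemma for the `+` family with `ε₁ = 2ε`. [cite: ElgindiLissMattingly2025, §1 (flat strips)] -/
theorem abs_sub_one_le_of_cutoff_ne_zero {V : ℝ → ℝ} {ε : ℝ} (hε : 0 < ε) (hV1 : ∀ y, V y ≤ 1) {y : ℝ}
    (h : smoothTransition ((V y - (1 - 2 * ε)) / ε) ≠ 0) : |V y - 1| ≤ 2 * ε := by
  have h1 := lt_of_cutoff_ne_zero hε h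
  rw [abs_le]; constructor <;> linarith [hV1 y]

/-- **The cut-off is `1` on the deep flat**: `V(y) ≥ 1 − ε ⇒ X(y) = 1` (`ε > 0`).
[cite: ElgindiLissMattingly2025, §1 (flat strips)] -/
theorem cutoff_eq_one {V : ℝ → ℝ} {ε : ℝ} (hε : 0 < ε) {y : ℝ} (hy : 1 - ε ≤ V y) :
    smoothTransition ((V y - (1 - 2 * ε)) / ε) = 1 :=
  Real.smoothTransition.one_of_one_le (by rw [le_div_iff₀ hε]; linarith)

/-- **Disjointness of the two families**: with `X⁻` the cut-off of `−V`, `X⁺·X⁻ = 0` as soon as `ε ≤ 1/2` (the two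
conditions `V > 1 − 2ε ≥ 0` and `−V > 1 − 2ε ≥ 0` are incompatible) — the hypothesis `hdis` of the un-gauging step.
[cite: ElgindiLissMattingly2025, §1 (the two slope families ±1)] -/
theorem cutoff_mul_cutoff_neg_eq_zero {V : ℝ → ℝ} {ε : ℝ} (hε : 0 < ε) (hε2 : ε ≤ 1 / 2) (y : ℝ) :
    smoothTransition ((V y - (1 - 2 * ε)) / ε) * smoothTransition ((-V y - (1 - 2 * ε)) / ε) = 0 := by
  by_cases hp : smoothTransition ((V y - (1 - 2 * ε)) / ε) = 0
  · rw [hp, zero_mul]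
  · have h1 := lt_of_cutoff_ne_zero hε hp
    have h2 : smoothTransition ((-V y - (1 - 2 * ε)) / ε) = 0 :=
      Real.smoothTransition.zero_of_nonpos (div_nonpos_of_nonpos_of_nonneg (by linarith) hε.le)
    rw [h2, mul_zero]

/-- **Sub-partition**: `X⁺² + X⁻² ≤ 1` (`0 < ε ≤ 1/2`) — the hypothesis `hpart` of `…SlotFibreMax`.
[cite: ElgindiLissMattingly2025, §1 (the two slope families ±1)] -/
theorem cutoff_sq_add_cutoff_neg_sq_le_one {V : ℝ → ℝ} {ε : ℝ} (hε : 0 < ε) (hε2 : ε ≤ 1 / 2) (y : ℝ) :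
    smoothTransition ((V y - (1 - 2 * ε)) / ε) ^ 2 + smoothTransition ((-V y - (1 - 2 * ε)) / ε) ^ 2 ≤ 1 := by
  have h := cutoff_mul_cutoff_neg_eq_zero (V := V) hε hε2 y
  rcases mul_eq_zero.mp h with h0 | h0
  · rw [h0]
    have := cutoff_le_one (fun y => -V y) ε y
    have h0' := cutoff_nonneg (fun y => -V y) ε y
    nlinarith
  · rw [h0]
    have := cutoff_le_one V ε y
    have h0' := cutoff_nonneg V ε y
    nlinarith

/-- **The zone**: where the two cut-offs do not add up to `1`, the slope is off both flats: `|V(y)| < 1 − ε`.  (So the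
zone part `1 − X⁺ − X⁻` is supported in `{||V| − 1| > ε}`, whose measure the profile estimates control.)
[cite: ElgindiLissMattingly2025, §1 (corner strips)] -/
theorem abs_lt_of_cutoff_add_lt_one {V : ℝ → ℝ} {ε : ℝ} (hε : 0 < ε) {y : ℝ}
    (h : smoothTransition ((V y - (1 - 2 * ε)) / ε) + smoothTransition ((-V y - (1 - 2 * ε)) / ε) < 1) :
    |V y| < 1 - ε := by
  rw [abs_lt]
  constructor
  · by_contra hle
    push Not at hle
    have h1 : smoothTransition ((-V y - (1 - 2 * ε)) / ε) = 1 := cutoff_eq_one (V := fun y => -V y) hε (by linarith)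
    linarith [cutoff_nonneg V ε y]
  · by_contra hle
    push Not at hle
    have h1 : smoothTransition ((V y - (1 - 2 * ε)) / ε) = 1 := cutoff_eq_one hε hle
    linarith [cutoff_nonneg (fun y => -V y) ε y]

/-! ## Derivatives of the cut-off -/

/-- **Chain rule**: if `V` has derivative `v` at `y` then `X` has derivative `smoothTransition′((V(y) − (1−2ε))/ε)·(v/ε)`.
[folklore] -/
theorem hasDerivAt_cutoff {V : ℝ → ℝ} {ε v y : ℝ} (hV : HasDerivAt V v y) :
    HasDerivAt (fun y => smoothTransition ((V y - (1 - 2 * ε)) / ε))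
      (deriv smoothTransition ((V y - (1 - 2 * ε)) / ε) * (v / ε)) y := by
  have hin : HasDerivAt (fun y => (V y - (1 - 2 * ε)) / ε) (v / ε) y := (hV.sub_const _).div_const ε
  exact (differentiable_smoothTransition _).hasDerivAt.comp y hin

/-- **Flatness on the support of the derivative**: `X′(y) ≠ 0 ⇒ 1 − 2ε < V(y) < 1 − ε` (`ε > 0`); in particular
`|V(y) − 1| ≤ 2ε` — the second alternative of the slot lemma's `hflat`. [cite: ElgindiLissMattingly2025, §1 (flat strips)] -/
theorem mem_Ioo_of_deriv_cutoff_ne_zero {V : ℝ → ℝ} {ε : ℝ} (hε : 0 < ε) (hV : Differentiable ℝ V) {y : ℝ}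
    (h : deriv (fun y => smoothTransition ((V y - (1 - 2 * ε)) / ε)) y ≠ 0) :
    1 - 2 * ε < V y ∧ V y < 1 - ε := by
  rw [(hasDerivAt_cutoff (hV y).hasDerivAt).deriv] at h
  have h' : deriv smoothTransition ((V y - (1 - 2 * ε)) / ε) ≠ 0 := fun h0 => h (by rw [h0, zero_mul])
  constructor
  · by_contra hle; push Not at hle
    exact h' (deriv_smoothTransition_of_nonpos (div_nonpos_of_nonpos_of_nonneg (by linarith) hε.le))
  · by_contra hle; push Not at hle
    exact h' (deriv_smoothTransition_of_one_le (by rw [le_div_iff₀ hε]; linarith))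

/-- **First-derivative bound**: `|X′(y)| ≤ (C₁/ε)|V′(y)|` for any bound `C₁` of `|smoothTransition′|` (`ε > 0`).
[folklore] -/
theorem abs_deriv_cutoff_le {V : ℝ → ℝ} {ε : ℝ} (hε : 0 < ε) (hV : Differentiable ℝ V) {C₁ : ℝ}
    (hC₁ : ∀ x, |deriv smoothTransition x| ≤ C₁) (y : ℝ) :
    |deriv (fun y => smoothTransition ((V y - (1 - 2 * ε)) / ε)) y| ≤ C₁ / ε * |deriv V y| := by
  rw [(hasDerivAt_cutoff (hV y).hasDerivAt).deriv, abs_mul, abs_div, abs_of_pos hε]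
  calc |deriv smoothTransition ((V y - (1 - 2 * ε)) / ε)| * (|deriv V y| / ε)
      ≤ C₁ * (|deriv V y| / ε) := mul_le_mul_of_nonneg_right (hC₁ _) (by positivity)
    _ = C₁ / ε * |deriv V y| := by ring

/-- **Second derivative (chain and product rule)**: if `V′` has derivative `w` at `y` then
`X″(y) = smoothTransition″(s)·(V′(y)/ε)² + smoothTransition′(s)·(w/ε)`, `s = (V(y) − (1−2ε))/ε`. [folklore] -/
theorem hasDerivAt_deriv_cutoff {V : ℝ → ℝ} {ε : ℝ} (hV : Differentiable ℝ V) {y w : ℝ}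
    (hV' : HasDerivAt (deriv V) w y) :
    HasDerivAt (deriv fun y => smoothTransition ((V y - (1 - 2 * ε)) / ε))
      (deriv (deriv smoothTransition) ((V y - (1 - 2 * ε)) / ε) * (deriv V y / ε) * (deriv V y / ε) +
        deriv smoothTransition ((V y - (1 - 2 * ε)) / ε) * (w / ε)) y := by
  have hderiv : deriv (fun y => smoothTransition ((V y - (1 - 2 * ε)) / ε)) =
      fun y => deriv smoothTransition ((V y - (1 - 2 * ε)) / ε) * (deriv V y / ε) := by
    funext y; exact (hasDerivAt_cutoff (hV y).hasDerivAt).deriv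
  rw [hderiv]
  have hin : HasDerivAt (fun y => (V y - (1 - 2 * ε)) / ε) (deriv V y / ε) y :=
    ((hV y).hasDerivAt.sub_const _).div_const ε
  have h1 : HasDerivAt (fun y => deriv smoothTransition ((V y - (1 - 2 * ε)) / ε))
      (deriv (deriv smoothTransition) ((V y - (1 - 2 * ε)) / ε) * (deriv V y / ε)) y :=
    ((contDiff_deriv_smoothTransition.differentiable (by simp)) _).hasDerivAt.comp y hin
  have h2 : HasDerivAt (fun y => deriv V y / ε) (w / ε) y := hV'.div_const ε
  exact h1.mul h2

/-- **Second-derivative bound**: `|X″(y)| ≤ (C₂/ε²)V′(y)² + (C₁/ε)|V″(y)|` for bounds `C₁, C₂` of the first two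
derivatives of the smooth transition, `V` twice differentiable (`ε > 0`). [folklore] -/
theorem abs_deriv_deriv_cutoff_le {V : ℝ → ℝ} {ε : ℝ} (hε : 0 < ε) (hV : Differentiable ℝ V)
    (hV2 : Differentiable ℝ (deriv V)) {C₁ C₂ : ℝ} (hC₁ : ∀ x, |deriv smoothTransition x| ≤ C₁)
    (hC₂ : ∀ x, |deriv (deriv smoothTransition) x| ≤ C₂) (y : ℝ) :
    |deriv (deriv fun y => smoothTransition ((V y - (1 - 2 * ε)) / ε)) y| ≤
      C₂ / ε ^ 2 * deriv V y ^ 2 + C₁ / ε * |deriv (deriv V) y| := by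
  rw [(hasDerivAt_deriv_cutoff hV (hV2 y).hasDerivAt).deriv]
  have hC₁0 : 0 ≤ C₁ := (abs_nonneg _).trans (hC₁ 0)
  have hC₂0 : 0 ≤ C₂ := (abs_nonneg _).trans (hC₂ 0)
  refine (abs_add_le _ _).trans (add_le_add ?_ ?_)
  · rw [abs_mul, abs_mul, abs_div, abs_of_pos hε]
    have hv : |deriv V y| / ε * (|deriv V y| / ε) = deriv V y ^ 2 / ε ^ 2 := by
      rw [div_mul_div_comm, ← sq, ← sq, sq_abs]
    calc |deriv (deriv smoothTransition) ((V y - (1 - 2 * ε)) / ε)| * (|deriv V y| / ε) * (|deriv V y| / ε)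
        = |deriv (deriv smoothTransition) ((V y - (1 - 2 * ε)) / ε)| * (deriv V y ^ 2 / ε ^ 2) := by
          rw [mul_assoc, hv]
      _ ≤ C₂ * (deriv V y ^ 2 / ε ^ 2) := mul_le_mul_of_nonneg_right (hC₂ _) (by positivity)
      _ = C₂ / ε ^ 2 * deriv V y ^ 2 := by ring
  · rw [abs_mul, abs_div, abs_of_pos hε]
    calc |deriv smoothTransition ((V y - (1 - 2 * ε)) / ε)| * (|deriv (deriv V) y| / ε)
        ≤ C₁ * (|deriv (deriv V) y| / ε) := mul_le_mul_of_nonneg_right (hC₁ _) (by positivity)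
      _ = C₁ / ε * |deriv (deriv V) y| := by ring

/-! ## Smoothness and periodicity (the cut-offs are `ShearProfile`s) -/

/-- The cut-off of a smooth slope function is smooth. [folklore] -/
theorem contDiff_cutoff {V : ℝ → ℝ} (hV : ContDiff ℝ ∞ V) (ε : ℝ) :
    ContDiff ℝ ∞ (fun y => smoothTransition ((V y - (1 - 2 * ε)) / ε)) :=
  Real.smoothTransition.contDiff.comp ((hV.sub contDiff_const).div_const ε)

/-- The cut-off of a `1`-periodic slope function is `1`-periodic. [folklore] -/
theorem periodic_cutoff {V : ℝ → ℝ} (hV : Function.Periodic V 1) (ε : ℝ) :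
    Function.Periodic (fun y => smoothTransition ((V y - (1 - 2 * ε)) / ε)) 1 := fun y => by
  simp only [hV y]

/-- The derivative of the cut-off of a smooth slope function is smooth (so `X′` is again a profile, the `Xd` of the slot
lemma). [folklore] -/
theorem contDiff_deriv_cutoff {V : ℝ → ℝ} (hV : ContDiff ℝ ∞ V) (ε : ℝ) :
    ContDiff ℝ ∞ (deriv fun y => smoothTransition ((V y - (1 - 2 * ε)) / ε)) :=
  (contDiff_infty_iff_deriv.mp (contDiff_cutoff hV ε)).2

/-- The derivative of the cut-off of a smooth `1`-periodic slope function is `1`-periodic. [folklore] -/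
theorem periodic_deriv_cutoff {V : ℝ → ℝ} (hV : Function.Periodic V 1) (ε : ℝ) :
    Function.Periodic (deriv fun y => smoothTransition ((V y - (1 - 2 * ε)) / ε)) 1 := by
  intro y
  have h : (fun x => smoothTransition ((V (x + 1) - (1 - 2 * ε)) / ε)) =
      (fun y => smoothTransition ((V y - (1 - 2 * ε)) / ε)) := by
    funext z; simp only [hV z]
  rw [← deriv_comp_add_const (fun y => smoothTransition ((V y - (1 - 2 * ε)) / ε)) 1 y, h]

end Summit.AnomalousDissipation.AnomalousDissipation.Theorems.SawtoothPulseCascade.K1Cutoff
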